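import Summits.ABC.ABC.Theses.DefiniteXi
import Literature.NumberTheory.EllipticCurves.DegreeConjectureAbcMurtyProofs
import HarnessLib

/-!
# Stub-ideation k2, generation 10 (FAMILY 2 — RESHAPE) — `stub_primeToSixDegreeBound` (P6)
# crux `DefiniteXi.SteinbergCore` (stmt-ABC-15024), line `p6_tamagawa_split` (sha cda023e8)

Elaboration companion of `STUB-IDEAS-stub_primeToSixDegreeBound-2.md` (gen 10).  Gens 2–9 of this seat
(`…StubIdeas2G2 … G9`) stand by reference.  Imports: the ROUTE FILE and the Literature module
`DegreeConjectureAbcMurtyProofs` only — on 2026-08-31 both the `Theorems/DefiniteXiSteinbergCorePrimeRung`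
closure and k1 g2's work-file `STUB_IDEAS_stub_primeToSixDegreeBound_1_g2` are `remote:stale … unbuilt` on the
check farm, so their lemmas (H0 = `SteinbergCorePrimeRung.primeToSixDegreeBound_of_freyDegreeBound`, p162616;
H1 = `StubIdeas1G2.freyDegreeBound_of_ABC_of_facts`; `StubIdeas1G2.freyPeterssonUpper_of_modularity`) are
CITED by name, and the two definitions this file shares with k1 g2 (`FreyPeterssonUpper`, `AbcLe`) are copied
VERBATIM so that the citations compose definitionally.  Contents — all sorry-free:

* `Stub` = the registered stub verbatim (= `StubIdeas1G2.P6`, definitionally).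
* **H0** `stub_of_freyDegreeBound : FreyDegreeBound → Stub` (local 8-line copy of the tree lemma).
* **Z1 (gen-10 cell, homological / variational normal form, LANDED AS A THEOREM)**
  `deg_le_maninSq_mul_height`: by Zagier's identity `deg·covol(Λ_E) = 4π²c²‖f‖²` (tree, PROVED:
  `zagier_degree_formula_holds`), the Petersson upper bound `‖f‖² ≪_t N^{1+t}` for Frey curves (k1 g2
  `FreyPeterssonUpper`, PROVED from modularity: `freyPeterssonUpper_of_modularity`) and Silverman's
  `covol⁻¹ ≪ max(|c₄|³,|c₆|²)^{1/6} ≤ 24·max(|a|,|b|)` (tree: `covolume_rpow_neg_six_le_of_isNeronLatticeOf`,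
  `max_c₄_c₆_freyCurve_le`):  **`deg φ_D ≤ K_t · c_D² · N^{1+t} · max(|a|,|b|)` for EVERY datum `D` of every
  Frey curve** — unconditionally modulo BCDT.  This is where the Manin-symbol / Cremona–Zagier normal form of
  `deg` lands: every bound it yields carries the archimedean height `H = max(|a|,|b|)` to the first power.
* **Z1 residual = abc**: `ManinHeightCredit` (`c_D²·H ≤ C_ε N^{1+ε}` for the minimal datum) gives the stub
  (`stub_of_height_of_credit`) and, conversely, already gives abc (`abcLe_of_maninHeightCredit`,
  `abc_of_maninHeightCredit : … → ABC`, using only `c_D ≠ 0`, `N ∣ 2⁸ rad` and the existence of a minimal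
  datum).  So the reshape through the period / modular-symbol side is an EQUIVALENT restatement of the abc
  atom, not a weakening — the Family-2 verdict of gens 2–9, now with the period side certified by name.
-/

set_option linter.dupNamespace false

noncomputable section

namespace Summit.ABC.ABC.Cruxes.SteinbergCore.StubIdeas2G10

open scoped MatrixGroups
open Literature.NumberTheory.EllipticCurves Literature.NumberTheory.EllipticCurves.ModularForms
open Literature.NumberTheory.DiophantineGeometry Literature.NumberTheory.Automorphic
open CongruenceSubgroup UniqueFactorizationMonoid
open Summit.ABC.ABC.Theses.DefiniteXi

/-- The registered stub `stub_primeToSixDegreeBound` of `Lines/p6_tamagawa_split.lean`, verbatim. [folklore] -/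
def Stub : Prop :=
  ∀ ε : ℝ, 0 < ε → ∃ C : ℝ, ∀ a b : ℤ, IsCoprime a b → a * b * (a + b) ≠ 0 → ∀ (N : ℕ) [NeZero N],
    (Literature.NumberTheory.EllipticCurves.freyCurve a b).conductorNorm ℤ = N →
    ∀ D : Literature.NumberTheory.EllipticCurves.ModularForms.ModularParametrizationData
      (Literature.NumberTheory.EllipticCurves.freyCurve a b) N,
      (∀ D' : Literature.NumberTheory.EllipticCurves.ModularForms.ModularParametrizationData
        (Literature.NumberTheory.EllipticCurves.freyCurve a b) N, D.deg ≤ D'.deg) →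
      ((D.deg / (ordProj[2] D.deg * ordProj[3] D.deg) : ℕ) : ℝ) ≤ C * (N : ℝ) ^ (2 + ε)

/-- **H0** (= tree `SteinbergCorePrimeRung.primeToSixDegreeBound_of_freyDegreeBound`, p162616): the route
target gives the stub, `cps(deg D_min) ≤ deg D_min ≤ deg D₀ ≤ C·N^{2+ε}`. [folklore] -/
theorem stub_of_freyDegreeBound (hX : FreyDegreeBound) : Stub := by
  intro ε hε
  obtain ⟨C, hC⟩ := hX ε hε
  refine ⟨C, fun a b hab h0 N _ hN D hDmin => ?_⟩
  obtain ⟨D₀, hD₀⟩ := hC a b hab h0 N hN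
  have h1 : ((D.deg / (ordProj[2] D.deg * ordProj[3] D.deg) : ℕ) : ℝ) ≤ (D.deg : ℝ) := by
    exact_mod_cast Nat.div_le_self _ _
  have h2 : (D.deg : ℝ) ≤ (D₀.deg : ℝ) := by exact_mod_cast hDmin D₀
  exact h1.trans (h2.trans hD₀)

/-! ### Z1 — the homological / variational normal form lands at `c² · N^{1+t} · H` -/

/-- Petersson UPPER bound `(f,f) ≤ C₂(t) N^{1+t}` for the newform of every FREY curve — VERBATIM copy of k1 g2's
`StubIdeas1G2.FreyPeterssonUpper`, which is PROVED there from the Modularity theorem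
(`StubIdeas1G2.freyPeterssonUpper_of_modularity : exists_isNewformOf → FreyPeterssonUpper`, Mai–Murty 1994 §2 via
the tree's `exists_petersson_le_mul_rpow_of_exists_isNewformOf`). [folklore] -/
def FreyPeterssonUpper : Prop :=
  ∀ t : ℝ, 0 < t → ∃ C₂ : ℝ, ∀ a b : ℤ, IsCoprime a b → a * b * (a + b) ≠ 0 →
    ∀ (N : ℕ) [NeZero N], (freyCurve a b).conductorNorm ℤ = N →
      ∀ f : CuspForm (Gamma0 N) 2, IsNewformOf (freyCurve a b) f →
        (peterssonProduct (Gamma0 N) 2 f f).re ≤ C₂ * (N : ℝ) ^ (1 + t)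

/-- abc in the `≤`-currency of the Literature theorems (VERBATIM copy of k1 g2's `StubIdeas1G2.AbcLe`). [folklore] -/
def AbcLe : Prop :=
  ∀ ε : ℝ, 0 < ε → ∃ C : ℝ, ∀ a b c : ℕ, IsABCTriple a b c →
    (c : ℝ) ≤ C * ((rad a b c : ℕ) : ℝ) ^ (1 + ε)


/-- **Z1 rung (THEOREM modulo the Frey Petersson upper bound, itself PROVED from modularity in k1 g2).**
For every `t > 0` there is `K ≥ 0` with `deg φ_D ≤ K · c_D² · N^{1+t} · max(|a|,|b|)` for all coprime
`a, b` with `ab(a+b) ≠ 0`, `N` the conductor of `E_(a,b)`, and EVERY parametrisation datum `D` of `E_(a,b)`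
at level `N`.  Proof = Murty 1999 §2 without the abc step: Zagier `4π²c²(f,f) = deg·covol`,
`(f,f) ≤ C₂ N^{1+t}`, `covol⁻¹ ≤ (331776 A)^{1/6} · max(|a|,|b|)` (Silverman Cor. 2.3 on the Frey model).
[cite: MurtyCongruencePrimes1999, §2] [cite: ZagierCMB1985, §1 (p. 374)] -/
theorem deg_le_maninSq_mul_height (hUp : FreyPeterssonUpper) :
    ∀ t : ℝ, 0 < t → ∃ K : ℝ, 0 ≤ K ∧ ∀ a b : ℤ, IsCoprime a b → a * b * (a + b) ≠ 0 →
      ∀ (N : ℕ) [NeZero N], (freyCurve a b).conductorNorm ℤ = N →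
        ∀ D : ModularParametrizationData (freyCurve a b) N,
          (D.deg : ℝ) ≤ K * (D.maninConstant : ℝ) ^ 2 * (N : ℝ) ^ (1 + t) * max |(a : ℝ)| |(b : ℝ)| := by
  intro t ht
  obtain ⟨C₂, hC₂⟩ := hUp t ht
  obtain ⟨A, hA, hSil⟩ := covolume_rpow_neg_six_le_of_isNeronLatticeOf
  refine ⟨4 * Real.pi ^ 2 * max C₂ 0 * (331776 * A) ^ (1 / 6 : ℝ), by positivity,
    fun a b hab h0 N _ hN D => ?_⟩
  haveI := isElliptic_freyCurve h0
  have hNpos : (0 : ℝ) < N := by exact_mod_cast Nat.pos_of_ne_zero (NeZero.ne N)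
  -- Zagier's identity `4π² c² (f,f) = deg · covol`
  have hZ := congrArg Complex.re D.zagier_degree_formula_holds
  rw [Complex.re_ofReal_mul, Complex.ofReal_re] at hZ
  have hP0 : 0 ≤ (peterssonProduct (Gamma0 N) 2 D.f D.f).re :=
    D.zagier_degree_formula_holds.peterssonProduct_re_pos.le
  have hcov : 0 < ZLattice.covolume D.L.lattice := ZLattice.covolume_pos _ _
  -- the Petersson upper bound for the Frey curve
  have hP : (peterssonProduct (Gamma0 N) 2 D.f D.f).re ≤ max C₂ 0 * (N : ℝ) ^ (1 + t) :=
    (hC₂ a b hab h0 N hN D.f D.isNewformOf).trans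
      (mul_le_mul_of_nonneg_right (le_max_left _ _) (by positivity))
  -- Silverman on the Frey model: `covol⁻¹ ≤ (331776 A)^{1/6} · max(|a|,|b|)`
  set R : ℝ := max |(a : ℝ)| |(b : ℝ)| with hR
  have haR : |(a : ℝ)| ≤ R := le_max_left _ _
  have hbR : |(b : ℝ)| ≤ R := le_max_right _ _
  have hR0 : 0 ≤ R := (abs_nonneg _).trans haR
  have h6 : ZLattice.covolume D.L.lattice ^ (-(6 : ℝ)) ≤ (331776 * A) * R ^ 6 := by
    calc ZLattice.covolume D.L.lattice ^ (-(6 : ℝ))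
        ≤ A * ((max (|(freyCurve a b).c₄| ^ 3) (|(freyCurve a b).c₆| ^ 2) : ℚ) : ℝ) :=
          hSil (freyCurve a b) D.L D.isNeronLattice
      _ ≤ A * (331776 * R ^ 6) := mul_le_mul_of_nonneg_left (max_c₄_c₆_freyCurve_le haR hbR) hA.le
      _ = 331776 * A * R ^ 6 := by ring
  have hinv := inv_le_of_rpow_neg_six_le hcov (by positivity) hR0 h6
  have hdeg := deg_le_of_zagier_of_upper hcov hZ le_rfl hP0 hP hinv
  have hsq : |(D.c : ℝ)| ^ 2 = (D.maninConstant : ℝ) ^ 2 := sq_abs _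
  calc (D.deg : ℝ) ≤ 4 * Real.pi ^ 2 * |(D.c : ℝ)| ^ 2 * (max C₂ 0 * (N : ℝ) ^ (1 + t)) *
          ((331776 * A) ^ (1 / 6 : ℝ) * R) := hdeg
    _ = 4 * Real.pi ^ 2 * max C₂ 0 * (331776 * A) ^ (1 / 6 : ℝ) * (D.maninConstant : ℝ) ^ 2 *
          (N : ℝ) ^ (1 + t) * R := by rw [← hsq]; ring

/-- **The Z1 residual.**  What the period-side normal form leaves to prove for P6: for the MINIMAL datum,
`c_D² · max(|a|,|b|) ≤ C_ε · N^{1+ε}` (Manin constant squared times naive height against the conductor).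
[folklore] -/
def ManinHeightCredit : Prop :=
  ∀ ε : ℝ, 0 < ε → ∃ C : ℝ, ∀ a b : ℤ, IsCoprime a b → a * b * (a + b) ≠ 0 → ∀ (N : ℕ) [NeZero N],
    (freyCurve a b).conductorNorm ℤ = N →
    ∀ D : ModularParametrizationData (freyCurve a b) N,
      (∀ D' : ModularParametrizationData (freyCurve a b) N, D.deg ≤ D'.deg) →
      (D.maninConstant : ℝ) ^ 2 * max |(a : ℝ)| |(b : ℝ)| ≤ C * (N : ℝ) ^ (1 + ε)

/-- **Z1 ⟹ Stub given the residual**: height form (`t = ε/2`) + `ManinHeightCredit` (`ε/2`) + `cps n ≤ n`.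
[folklore] -/
theorem stub_of_height_of_credit (hUp : FreyPeterssonUpper) (hcr : ManinHeightCredit) :
    Stub := by
  intro ε hε
  have hε2 : 0 < ε / 2 := half_pos hε
  obtain ⟨K, hK0, hK⟩ := deg_le_maninSq_mul_height hUp (ε / 2) hε2
  obtain ⟨C, hC⟩ := hcr (ε / 2) hε2
  refine ⟨K * C, fun a b hab h0 N _ hN D hDmin => ?_⟩
  have hNpos : (0 : ℝ) < N := by exact_mod_cast Nat.pos_of_ne_zero (NeZero.ne N)
  have h1 : ((D.deg / (ordProj[2] D.deg * ordProj[3] D.deg) : ℕ) : ℝ) ≤ (D.deg : ℝ) := by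
    exact_mod_cast Nat.div_le_self _ _
  have h2 := hK a b hab h0 N hN D
  have h3 := hC a b hab h0 N hN D hDmin
  have hNt : (0 : ℝ) ≤ (N : ℝ) ^ (1 + ε / 2) := Real.rpow_nonneg hNpos.le _
  have hexp : (N : ℝ) ^ (1 + ε / 2) * (N : ℝ) ^ (1 + ε / 2) = (N : ℝ) ^ (2 + ε) := by
    rw [← Real.rpow_add hNpos]; congr 1; ring
  calc ((D.deg / (ordProj[2] D.deg * ordProj[3] D.deg) : ℕ) : ℝ) ≤ (D.deg : ℝ) := h1
    _ ≤ K * (D.maninConstant : ℝ) ^ 2 * (N : ℝ) ^ (1 + ε / 2) * max |(a : ℝ)| |(b : ℝ)| := h2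
    _ = K * (N : ℝ) ^ (1 + ε / 2) * ((D.maninConstant : ℝ) ^ 2 * max |(a : ℝ)| |(b : ℝ)|) := by ring
    _ ≤ K * (N : ℝ) ^ (1 + ε / 2) * (C * (N : ℝ) ^ (1 + ε / 2)) :=
        mul_le_mul_of_nonneg_left h3 (mul_nonneg hK0 hNt)
    _ = K * C * (N : ℝ) ^ (2 + ε) := by rw [← hexp]; ring

/-- **The residual is abc-strength**: `ManinHeightCredit` implies the `≤`-form of abc (`AbcLe`; the strict
summit form follows by the tree's `abcLt_of_abcLe`, next theorem), using only `c_D ≠ 0` (tree, PROVED: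
`maninConstant_ne_zero_holds`), `N_(a,b) ∣ 2⁸·rad(ab(a+b))` (tree, PROVED: `conductorNorm_freyCurve_dvd_holds`)
and the existence of a minimal datum (`hex`; = modularity + well-ordering of `ℕ`). [folklore] -/
theorem abcLe_of_maninHeightCredit
    (hex : ∀ a b : ℤ, IsCoprime a b → a * b * (a + b) ≠ 0 → ∀ (N : ℕ) [NeZero N],
      (freyCurve a b).conductorNorm ℤ = N →
      ∃ D : ModularParametrizationData (freyCurve a b) N,
        ∀ D' : ModularParametrizationData (freyCurve a b) N, D.deg ≤ D'.deg)
    (hcr : ManinHeightCredit) : AbcLe := by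
  intro ε hε
  obtain ⟨C, hC⟩ := hcr ε hε
  refine ⟨2 * max C 0 * (2 ^ 8 : ℝ) ^ (1 + ε), fun a b c habc => ?_⟩
  obtain ⟨ha, hb, hsum, hcop⟩ := habc
  have hab : IsCoprime (a : ℤ) (b : ℤ) := Nat.isCoprime_iff_coprime.mpr hcop
  have ha' : (0 : ℤ) < a := by exact_mod_cast ha
  have hb' : (0 : ℤ) < b := by exact_mod_cast hb
  have h0 : (a : ℤ) * b * (a + b) ≠ 0 := by positivity
  haveI := isElliptic_freyCurve h0
  haveI : NeZero ((freyCurve (a : ℤ) (b : ℤ)).conductorNorm ℤ) :=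
    ⟨(WeierstrassCurve.conductorNorm_pos_holds (freyCurve (a : ℤ) (b : ℤ))).ne'⟩
  obtain ⟨D, hD⟩ := hex a b hab h0 _ rfl
  have hcr' : (D.maninConstant : ℝ) ^ 2 * max |((a : ℤ) : ℝ)| |((b : ℤ) : ℝ)| ≤
      C * (((freyCurve (a : ℤ) (b : ℤ)).conductorNorm ℤ : ℕ) : ℝ) ^ (1 + ε) :=
    hC a b hab h0 _ rfl D hD
  -- `c_D² ≥ 1`
  have hc1 : (1 : ℝ) ≤ (D.maninConstant : ℝ) ^ 2 := by
    have hz : D.maninConstant ≠ 0 := D.maninConstant_ne_zero_holds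
    have h1 : (1 : ℤ) ≤ |D.maninConstant| := Int.one_le_abs hz
    have h2 : (1 : ℤ) ≤ D.maninConstant ^ 2 := by
      calc (1 : ℤ) = 1 ^ 2 := by norm_num
        _ ≤ |D.maninConstant| ^ 2 := pow_le_pow_left₀ zero_le_one h1 2
        _ = D.maninConstant ^ 2 := sq_abs _
    exact_mod_cast h2
  -- `c ≤ 2 · max(|a|,|b|)`
  have hm0 : 0 ≤ max |((a : ℤ) : ℝ)| |((b : ℤ) : ℝ)| := le_max_of_le_left (abs_nonneg _)
  have hmax : (c : ℝ) ≤ 2 * max |((a : ℤ) : ℝ)| |((b : ℤ) : ℝ)| := by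
    have hca : (c : ℝ) = (a : ℝ) + (b : ℝ) := by rw [← hsum]; push_cast; ring
    rw [Int.cast_natCast, Int.cast_natCast, abs_of_nonneg (Nat.cast_nonneg a),
      abs_of_nonneg (Nat.cast_nonneg b), hca]
    have h1 := le_max_left (a : ℝ) (b : ℝ)
    have h2 := le_max_right (a : ℝ) (b : ℝ)
    linarith
  -- `N ≤ 2⁸ · rad(abc)`
  have hNle : (((freyCurve (a : ℤ) (b : ℤ)).conductorNorm ℤ : ℕ) : ℝ) ≤ 2 ^ 8 * ((rad a b c : ℕ) : ℝ) := by
    have hdvd := conductorNorm_freyCurve_dvd_holds (a : ℤ) (b : ℤ) hab h0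
    have hprod : ((a : ℤ) * b * (a + b)).natAbs = a * b * c := by
      rw [← hsum, show ((a : ℤ) + b) = ((a + b : ℕ) : ℤ) from (Nat.cast_add a b).symm]
      simp only [Int.natAbs_mul, Int.natAbs_natCast]
    have hrad : (radical ((a : ℤ) * b * (a + b))).natAbs = rad a b c := by
      rw [← Int.radical_natAbs_eq_radical, Int.natAbs_natCast, hprod, rad_def]
    rw [hrad] at hdvd
    have hpos : 0 < 2 ^ 8 * rad a b c := by
      rw [rad_def]; exact mul_pos (by norm_num) (Nat.pos_of_ne_zero radical_ne_zero)
    exact_mod_cast Nat.le_of_dvd hpos hdvd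
  have hNnn : (0 : ℝ) ≤ (((freyCurve (a : ℤ) (b : ℤ)).conductorNorm ℤ : ℕ) : ℝ) := Nat.cast_nonneg _
  have hrp : (((freyCurve (a : ℤ) (b : ℤ)).conductorNorm ℤ : ℕ) : ℝ) ^ (1 + ε) ≤
      (2 ^ 8 * ((rad a b c : ℕ) : ℝ)) ^ (1 + ε) :=
    Real.rpow_le_rpow hNnn hNle (by linarith)
  calc (c : ℝ) ≤ 2 * max |((a : ℤ) : ℝ)| |((b : ℤ) : ℝ)| := hmax
    _ ≤ 2 * ((D.maninConstant : ℝ) ^ 2 * max |((a : ℤ) : ℝ)| |((b : ℤ) : ℝ)|) := by nlinarith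
    _ ≤ 2 * (C * (((freyCurve (a : ℤ) (b : ℤ)).conductorNorm ℤ : ℕ) : ℝ) ^ (1 + ε)) := by linarith
    _ ≤ 2 * (max C 0 * (((freyCurve (a : ℤ) (b : ℤ)).conductorNorm ℤ : ℕ) : ℝ) ^ (1 + ε)) :=
        mul_le_mul_of_nonneg_left
          (mul_le_mul_of_nonneg_right (le_max_left _ _) (Real.rpow_nonneg hNnn _)) (by norm_num)
    _ ≤ 2 * (max C 0 * (2 ^ 8 * ((rad a b c : ℕ) : ℝ)) ^ (1 + ε)) :=
        mul_le_mul_of_nonneg_left (mul_le_mul_of_nonneg_left hrp (le_max_right _ _)) (by norm_num)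
    _ = 2 * max C 0 * (2 ^ 8 : ℝ) ^ (1 + ε) * ((rad a b c : ℕ) : ℝ) ^ (1 + ε) := by
        rw [Real.mul_rpow (by norm_num) (Nat.cast_nonneg _)]; ring

/-- … hence the summit statement in its strict form (tree `abcLt_of_abcLe`; `ABC_iff` is `Iff.rfl`). [folklore] -/
theorem abc_of_maninHeightCredit
    (hex : ∀ a b : ℤ, IsCoprime a b → a * b * (a + b) ≠ 0 → ∀ (N : ℕ) [NeZero N],
      (freyCurve a b).conductorNorm ℤ = N →
      ∃ D : ModularParametrizationData (freyCurve a b) N,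
        ∀ D' : ModularParametrizationData (freyCurve a b) N, D.deg ≤ D'.deg)
    (hcr : ManinHeightCredit) : _root_.ABC :=
  ABC_iff.mpr (abcLt_of_abcLe (abcLe_of_maninHeightCredit hex hcr))

end Summit.ABC.ABC.Cruxes.SteinbergCore.StubIdeas2G10

end
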